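import Summits.QuantumFields.YangMills.Theorems.BalabanUVNodesN26AtRecord13StubD4TowerFlat
import Summits.QuantumFields.YangMills.Theorems.BalabanUVNodesN26AtTheta13OfThm1C

/-!
# DAG node N26 ∕ row (D4) — CRUX K2‴'s REGISTERED STUB `stub_d4AtSlopeCont13 : D4AtSlopeOfD1Record13` (stmt-QuantumFields-19911) READ AT NODE 00's
# [15]-KEYED STAGE-13 WITNESS `θ₁₅ᶜ = Node00.theta13OfThm1C F N ε₀ ε₂₉ B₃ a₀ a₁` WITH NODE D SUPPLIED (NE9's flat tower operator) AND THE β-SIDE ROWS PAID: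
# §1 the stub's consequent at `(F, θ₁₅ᶜ, Lc, Nc)` with N1 DISCHARGED modulo `hsmall₁` ∕ `hA₂` (p494008 at θ := θ₁₅ᶜ); §2 for EVERY positive slope `s`, ONE member
# `ε₂₉(s)` of the family at which `∃ γ₁ ∈ ]0, θ₁₅ᶜ.γ], AtSlopeCont (split₁₃ θ₁₅ᶜ) γ₁ s` holds from the NODE O ∕ B ∕ E inputs, `Valid` and (C-leaf) ALONE

Cell pub-balaban, β-function sub-cell, BINDER row (D4) OWNER lineage `b2b-balaban-beta-an4` (gen 128; memo
`HOME/b2b-balaban-beta-an4/FLAT-LETTERS-LOCATED.md` §39).  Context.  Crux K2‴ `EndpointGivenBR13` (plan g66 rev 16∕17, `K2Skeleton13.lean` 3f282f2ad62aefca) registers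
`stub_d4AtSlopeCont13 : D4AtSlopeOfD1Record13` := `∀ F (θ : Stage13Params F 2) (hP : θ.Provisos₁₃ F 2), θ.Admissible F 2 → ∀ Lc [NeZero Lc] Js Nc, (the (D1) pin on the
record's `β⁰`) → D1Residue.Residue Lc Js Nc 0 1 → ∃ γ₀, 0 < γ₀ ∧ γ₀ ≤ θ.γ ∧ AtSlopeCont (oneLoopSplit_betaOfMerged βm₁₃ (beta0OfMerged βm₁₃ θ.v₀) θ.γ) γ₀ (stepBal Nc Lc)`
— THIS ROW's deliverable at Record 13.  Its `∀ θ` ranges over admissible tuples where the printed (D4) rows FAIL (the pinned live witness `theta13LiveOfRecord`, ε₂₉ = ⅛: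
n26-c p492818 `not_condsL_faithful_theta13LiveOfRecord`; dag-ref-D READ-148∕157∕160), so every (D4)-side theorem is a reduction AT θ with the rows displayed, and the
open question of record (ref-D #160∕#164, ym-nodeO-ideate P3 EVIDENCE-54 v3 (T6‴), this row's READ pub-ymgap l.16404) is whether ONE member of node00-def-K0a's candidate
family meets all rows.  dag-n26-c g7 answered the β-side half at the COMPATIBLE [15]-keyed witness `θ₁₅ᶜ` (`…N26AtTheta13OfThm1C`, p497784 ✓ commit 2407a36995b2, 2026-08-27T04:48Z):
`condsL_faithful_theta13OfThm1C_of_eps_le` (N1 at the faithful letters `{ c₀ with ε₁ := ε₂₉ }` ⟸ `hsmall₁ ∧ hA₂`, both κ rows paid by `κ = 2·10⁴`) and ★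
`exists_eps29_rows_theta13OfThm1C` (for every slope `s > 0` one member meets row G, row Z, N1 and the seam row `ε₂₉·K_rem,L ≤ s` at once), and read the stub there on the
NODE-D-DISPLAYED family road (`d4AtSlopeOfD1Record13_at_theta13OfThm1C_of_family`, over its p494179).

WHY THIS FILE.  This row's currency supplies NODE D: p492935 (`…N26AtRecord13FamilyTowerFlat`) builds the (190) datum on the members' tori from NE9's flat tower operator
`H₁,k(1)` (zero background, one-domain tower, value line, one source direction — the MODEL class) and p494008 (`…N26AtRecord13StubD4TowerFlat`) reads the registered stub's
consequent at `(F, θ, Lc, Nc)` from it.  Here both are instantiated AT θ₁₅ᶜ with n26-c's β-side rows plugged in BY NAME: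
* §1 `d4AtSlopeOfD1Record13_at_theta13OfThm1C_of_family_towerFlat` — p494008 at `θ := θ₁₅ᶜ`, faithful letters `{ c₀ with ε₁ := ε₂₉ }`, `hC` := n26-c's
  `condsL_faithful_theta13OfThm1C_of_eps_le hsmall₁ hA₂`: the stub's consequent at `(F, θ₁₅ᶜ, Lc, Nc)` with NODE D SUPPLIED, N1 DISCHARGED modulo the two displayed numeric
  rows, no κ hypothesis (the TOWERFLAT twin of n26-c's §2 road theorem).
* §2 ★ `exists_eps29_d4AtSlope_theta13OfThm1C_of_family_towerFlat` — n26-c's `exists_eps29_rows_theta13OfThm1C` ∘ p492935 clause (ii): for `0 < ε₀`, `0 ≤ B₃`, `0 < a₀`,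
  `0 < a₁`, NE9's structure data and numerics, a box `γ₀`, channel, (4.4)-radius, residual `c₀` and EVERY SLOPE `s > 0`, THERE IS a member `ε₂₉ > 0` (`4ε₂₉ < ε₀`, θ₁₅ᶜ
  ADMISSIBLE, `ZtUnity`) at which — from the Stage-12 [B13] family of record with N10's leaf + member letters law, the (1.22) identification at the ₁₃ merged β, the run
  sequences ∕ laws ∕ `Restr` (NODE O ∕ 00 ∕ A), the (4.4) seams from the tower's fine bond fields with holomorphic activities (NODE B), the (1.7) data with `hconv` on the
  explicit flat (4.35) vectors and the read-out (NODE E), N3, `0 < γ₀`, `Valid` and (C-leaf) ALONE — `∃ γ₁, 0 < γ₁ ∧ γ₁ ≤ θ₁₅ᶜ.γ ∧ AtSlopeCont (split₁₃ θ₁₅ᶜ) γ₁ s`: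
  the N1 row AND the seam row `ε₂₉·K_rem,L ≤ s` are CONSUMED (paid by the choice of the member, `ε₂₉` chosen after `s`), NODE D is SUPPLIED.  This is the (D4) OWNER's
  deliverable «rows consumed, NODE D supplied» (READ l.16404 (2)) realised on the «witness with small ε₂₉» branch (n26-c g7 ATTENTION-ROUTE (9)) rather than under a
  `Rows F θ` re-typing — the strongest honest (D4)-side statement at the K0‴ candidate family today.

HONEST FRAMING.  Compositions BY NAME (0 `def`, 0 `sorry`; one application each of p494008 ∕ p492935 with n26-c's two lemmas); REDUCTIONS, NOT proofs of the stub: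
`stub_d4AtSlopeCont13`'s `∀ θ` is untouched (above the threshold the (D4) road does not reach it), and at the member every remaining input is displayed — the objects of
NODE O ∕ 00 ∕ A (family, identification, runs), NODE B (seams), NODE E (test-vector data; on the model class `hconv` alone = the thermodynamic limit of `H₁,k(1)`'s
kernel), N3, `Valid`, (C-leaf).  The slope `s` of §2 is a FREE positive letter: at a (D1) datum `(Lc, Js, Nc)` of the member it is `stepBal Nc Lc` (§1's shape), and
whether the members' (D1) slopes admit a common positive lower bound as `ε₂₉ ↓ 0` (print: `β⁰_{k+1}` does not read the (2.9) threshold, [I] (2.12)–(2.13) p. 268) is the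
(D1) lane's sentence — §2 does NOT choose `ε₂₉` after a (D1) datum of the same member.  NODE D on the MODEL class.  (D4) INSTANCE 0∕1, D4 DISCHARGE NO DATE; K2‴ NOT
proved; N25 ∕ N26 NOT discharged; counts unmoved.  One finite four-torus programme at fixed ε per run — NOT the continuum limit, NOT ℝ⁴, NOT infinite volume, NOT OS,
NOT a mass gap, NOT Clay.  No `instance`, no `notation`, no `axiom`.
Sources (context): [I] = [Balaban1987RG1] CMP **109** (1987): Thm 2 p. 259, (1.7) p. 261, (1.18) p. 263, (1.20)–(1.22) p. 264, (2.9) p. 266, (2.12)–(2.13) p. 268,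
(4.4) p. 281, (4.35) p. 290, (5.1) p. 292; [II] = [Balaban1988RG2Cluster] CMP **116** (1988): Lemma 3 (2.38) p. 20, p. 21; [III] = [Balaban1988Convergent] CMP **119**
(1988): (2.10) p. 256; [15] = [Balaban1985Variational] CMP **102** (1985): Thm 1 p. 279, (190) p. 308.
-/

noncomputable section

open scoped Matrix.Norms.L2Operator InnerProductSpace ComplexConjugate

namespace Summit.QuantumFields.YangMills.Theorems.BalabanUVNodesN26AtTheta13OfThm1CStubD4TowerFlat

open Literature.MathematicalPhysics.QuantumFieldTheory.Balaban1983to89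
open Literature.MathematicalPhysics.QuantumFieldTheory.Balaban1983to89.FlowStep
open Literature.MathematicalPhysics.QuantumFieldTheory.Balaban1983to89.T4Continuum (T4Family)
open Literature.MathematicalPhysics.QuantumFieldTheory.Balaban1983to89.Node00
open Literature.MathematicalPhysics.QuantumFieldTheory.Balaban1983to89.B13ScaleTransfer (Pt)
open Literature.MathematicalPhysics.QuantumFieldTheory.Balaban1983to89.TreeLengthTorus (TPt TDom proj)
open Literature.MathematicalPhysics.QuantumFieldTheory.Balaban1983to89.B4Sect5Torus (TSite)
open Literature.MathematicalPhysics.QuantumFieldTheory.Balaban1983to89.B12Decay510 (mixedDeriv)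
open Literature.MathematicalPhysics.QuantumFieldTheory.Balaban1983to89.B12Decay510Torus (tcubeOf)
open Literature.MathematicalPhysics.QuantumFieldTheory.Balaban1983to89.B9SectCLatticeCarrier (Bond bpos)
open Literature.MathematicalPhysics.QuantumFieldTheory.Balaban1983to89.B9Eq311L2Pairing (WL2)
open Literature.MathematicalPhysics.QuantumFieldTheory.Balaban1983to89.B9Eq315QTower (towerP UlevOf)
open Literature.MathematicalPhysics.QuantumFieldTheory.Balaban1983to89.B9Eq315QTorus (perCfg cornerSite)
open Literature.MathematicalPhysics.QuantumFieldTheory.Balaban1983to89.B9Eq319QprimeTorus (blockCoord)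
open Literature.MathematicalPhysics.QuantumFieldTheory.Balaban1983to89.B9Eq316TowerFlatIsOneStep (siteCast towerP_eq_fineP_pow)
open Literature.MathematicalPhysics.QuantumFieldTheory.Balaban1983to89.B7Prop1Explicit (U1 Wcx boxVec)
open Literature.MathematicalPhysics.QuantumFieldTheory.Balaban1983to89.B7Prop2Explicit (c2')
open Literature.MathematicalPhysics.QuantumFieldTheory.Balaban1983to89.B11Eq103H1Complex (BondL2K)
open Literature.MathematicalPhysics.QuantumFieldTheory.Balaban1983to89.B9Eq326OperatorTower (laplaceAk H1k)
open Literature.MathematicalPhysics.QuantumFieldTheory.Balaban1983to89.Beta.RemainderChainLattice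
open Literature.MathematicalPhysics.QuantumFieldTheory.Balaban1983to89.Beta.RemainderLimitTorus (LDom limKernel tproj)
open Literature.MathematicalPhysics.QuantumFieldTheory.Balaban1983to89.Beta.RemainderDecay190 (Consts190 Data190)
open Literature.MathematicalPhysics.QuantumFieldTheory.Balaban1983to89.Beta.RemainderDecay190HoloChain (ChainTFac190H)
open Literature.MathematicalPhysics.QuantumFieldTheory.Balaban1983to89.Beta.RemainderWOfRecordB13 (SpLaw Law213 NOfLayers)
open Summit.QuantumFields.BalabanUV.Gaps
open Summit.QuantumFields.BalabanUV.Gaps.BetaContFromD4Chain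
open Summit.QuantumFields.YangMills.Theorems.BalabanUVNodesN26AtRecord13FamilyTowerFlat
  (exists_chainTFac190H_betaOfRecord₁₃_of_family_towerFlat)
open Literature.MathematicalPhysics.QuantumFieldTheory.Balaban1983to89.B12TreeDecay (K₀)
open Summit.QuantumFields.YangMills.Theorems.BalabanUVNodesN26AtRecord13StubD4TowerFlat
  (d4AtSlopeOfD1Record13_at_of_family_towerFlat)
open Summit.QuantumFields.YangMills.Theorems.BalabanUVNodesN26AtTheta13OfThm1C
  (condsL_faithful_theta13OfThm1C_of_eps_le exists_eps29_rows_theta13OfThm1C)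
open Metric Filter Topology

variable (F : T4Family) (N : ℕ) [NeZero N]

section AtTheta15C


-- NE9's tower structure data ([5] §3 ∕ [15]: block size `L ≥ 3`, the C⋆-algebra `𝔸`, its Hilbert model `W ≃ 𝔸`, the trace `τ`, `a, a′, ρ_w, A_Q`; the letters `a, a′` are `aQ, aQ'` here — K0a's witness owns the names `a₀, a₁`)
variable (L : ℕ) [NeZero L] (hL : 1 ≤ L) (hL3 : 3 ≤ L)
  {𝔸 : Type*} [CStarAlgebra 𝔸] [Nontrivial 𝔸]
  {W : Type} [NormedAddCommGroup W] [InnerProductSpace ℂ W] [FiniteDimensional ℂ W] (φ : W ≃ₗ[ℂ] 𝔸)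
  {Mφ Mφ' : ℝ} (hMφ : 0 ≤ Mφ) (hMφ' : 0 ≤ Mφ') (hφ : ∀ w, ‖φ w‖ ≤ Mφ * ‖w‖) (hφ' : ∀ X, ‖φ.symm X‖ ≤ Mφ' * ‖X‖)
  {aQ : ℝ} (haQ : 0 < aQ) {aQ' : ℝ} (haQ' : 0 < aQ')
  (τ : 𝔸 →ₗ[ℂ] ℂ) {Cτ : ℝ} (hτ : ∀ X, ‖τ X‖ ≤ Cτ * ‖X‖) (hCτ : 0 ≤ Cτ) {Mτ : ℝ}
  (hτm : ∀ X Y : 𝔸, ‖τ (X * Y)‖ ≤ Mτ * ‖X‖ * ‖Y‖) (hMτ : 0 ≤ Mτ) {ρw : ℝ} (hρw : 0 ≤ ρw)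
  (hτ₁ : ∀ X : 𝔸, τ (star X) = conj (τ X)) (hτ₂ : ∀ X Y : 𝔸, τ (X * Y) = τ (Y * X))
  (hφτ : ∀ X Y : 𝔸, ⟪φ.symm X, φ.symm Y⟫_ℂ = τ (star X * Y))
  (AQ : ℝ) (hAQ16 : 16 * (((4 : ℕ) : ℝ) + 1) * (((4 : ℕ) : ℝ) + 4) * c2' 4 L ≤ AQ)

include hL3 hMφ hMφ' hφ hφ' haQ haQ' hτ hCτ hτm hMτ hρw hτ₁ hτ₂ hφτ hAQ16

/-! ## §1 The registered K2‴ stub's consequent AT `(F, θ₁₅ᶜ, Lc, Nc)` with NODE D SUPPLIED and N1 DISCHARGED modulo `hsmall₁` ∕ `hA₂` (p494008 at θ := θ₁₅ᶜ, `hC` by n26-c's §1) -/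

variable (ε₀ ε₂₉ B₃ a₀ a₁ : ℝ) (c₀ : B13.Consts)

/-- **CRUX K2‴'s REGISTERED STUB `stub_d4AtSlopeCont13 : D4AtSlopeOfD1Record13` — ITS CONSEQUENT AT `(F, θ₁₅ᶜ, Lc, Nc)` IN THE STUB's OWN LETTERS AT NODE 00's COMPATIBLE
[15]-KEYED WITNESS `θ₁₅ᶜ = theta13OfThm1C F N ε₀ ε₂₉ B₃ a₀ a₁`, WITH NODE D SUPPLIED BY NE9's FLAT TOWER OPERATOR AND N1 DISCHARGED modulo `hsmall₁` ∕ `hA₂`**: p494008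
`d4AtSlopeOfD1Record13_at_of_family_towerFlat` at `θ := θ₁₅ᶜ` and the FAITHFUL letters `cR := { c₀ with ε₁ := ε₂₉ }`, its N1 slot `hC` fed by n26-c's
`condsL_faithful_theta13OfThm1C_of_eps_le hsmall₁ hA₂` (both κ rows paid by θ₁₅ᶜ's `κ = 2·10⁴`).  Displayed: NE9's structure data (section variables) and thresholds `(δs, Cs)`,
tower weights, cube side ∕ geometry letters ∕ numerics on `q`; AT θ₁₅ᶜ the Stage-12 [B13] family of record `lamF` with N10's family leaf and the member letters law at the
faithful letters, the leaf kernels `A1` with the (1.22) identification at the ₁₃ merged β, the run sequences with growing tori ∕ laws ∕ `Restr` (NODE O ∕ 00 ∕ A); the open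
letter below the threshold `hsmall₁ : 2(F.L+2)⁴·A₁·K₀(c₀)·ε₂₉·e^{100001}·K₀(64,8)·576 ≤ 1` and `hA₂ : e·576·K₀(64,8)² ≤ A₂`; N3; ANY regularity display ∕ positivity witness
per (k, v, m); the (4.4) seams FROM THE TOWER's FINE BOND FIELDS with holomorphic activities (NODE B); the (1.7) data with `hconv` READ ON THE EXPLICIT FLAT (4.35) VECTORS and
the read-out (NODE E); `0 < γ₀`, `Valid`, the one-loop slope `ε₂₉·K_rem,L ≤ stepBal Nc Lc`, (C-leaf) ⟹ `∃ γ₁, 0 < γ₁ ∧ γ₁ ≤ θ₁₅ᶜ.γ ∧ AtSlopeCont (split₁₃ θ₁₅ᶜ) γ₁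
(stepBal Nc Lc)` — at `N := 2` LITERALLY `D4AtSlopeOfD1Record13`'s consequent at `(F, θ₁₅ᶜ, hP, hAdm, Lc, Js, Nc)` (the (D1) antecedents unused by the (D4) side).  The
TOWERFLAT twin of n26-c's `d4AtSlopeOfD1Record13_at_theta13OfThm1C_of_family` (there NODE D is displayed as `Wn ∕ D`).  A REDUCTION of the stub AT θ₁₅ᶜ — NOT a proof of
it (its `∀ θ` includes members above the threshold); NODE D on the MODEL class; instance 0∕1.
[cite: Balaban1988RG2Cluster, Lemma 3 (2.38) p.20 and p.21; Balaban1987RG1, Thm 2 p.259, (1.7) p.261, (1.18) p.263, (1.20)-(1.22) p.264, (2.9) p.266, (4.4) p.281, (4.35) p.290, (5.1) p.292; Balaban1985Variational, Thm 1 p.279, (190) p.308] -/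
theorem d4AtSlopeOfD1Record13_at_theta13OfThm1C_of_family_towerFlat :
    ∃ δs Cs : ℝ, 0 < δs ∧ 0 ≤ Cs ∧
      ∀ -- tower weights per scale `k` (height `k + 1`)
        (η : ℕ → ℝ) (_hηL : ∀ k, η k * (L : ℝ) ^ (k + 1) = 1) (cw₀ cw₁ : ℕ → ℝ) [∀ k, Fact (0 < cw₀ k)] [∀ k, Fact (0 < cw₁ k)]
        (_hw : ∀ k, cw₀ k * ((L : ℝ) ^ (k + 1)) ^ 4 = cw₁ k) (_hρ : ∀ k, |η k| ^ 4 / cw₀ k ≤ ρw)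
        -- cube side, size indices, block-geometry letters, source direction ∕ value, the (190)-record under numerics only
        (M : ℕ) [NeZero M] (I : Type) (_i₀ : I) (η₀ L₀ M₀ Rg : ℕ → ℝ) (Hg : ℕ → Prop) (μ₀ : Fin 4) (w₀ : W)
        (q : Consts190) (δr : ℝ) (_hδr : 0 < δr) (_hσ₀ : 0 < q.σ) (_hcR : B6.c0 δr (q.σ / δr) ^ 4 ≤ q.cR) (_hκB : 1 ≤ q.κB)
        (_hδ15 : q.δ15 ≤ δs) (_hCst : Cs ≤ q.Cst) (_hmw : ‖w₀‖ ≤ q.m) (_hθ1 : q.θ ≤ 1)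
        -- a Stage-12 [B13] FAMILY of record AT θ₁₅ᶜ's Stage-12 part with the FAITHFUL letters, the box, the leaf kernels with the (1.22) identification AT θ₁₅ᶜ's STAGE-13 MERGED β
        (γ₀ : ℝ) (μ ν : Fin 4) (α₂ : ℝ) (lamF : ResidB13Fam₁₂ F N (theta13OfThm1C F N ε₀ ε₂₉ B₃ a₀ a₁).toStage12Params)
        (_hle : γ₀ ≤ (theta13OfThm1C F N ε₀ ε₂₉ B₃ a₀ a₁).γ) (A1 : (k : ℕ) → (Fin (k + 1) → ℝ) → LDom 4 → Pt 4 → ℝ)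
        (_hm : letI := (theta13OfThm1C F N ε₀ ε₂₉ B₃ a₀ a₁).instVβ₁; letI := (theta13OfThm1C F N ε₀ ε₂₉ B₃ a₀ a₁).instVβ₂
          letI := (theta13OfThm1C F N ε₀ ε₂₉ B₃ a₀ a₁).instιβ
          ∀ k (v : Fin (k + 1) → ℝ), v ∈ Box γ₀ k →
            betaMerged F (mergedTermFamilyMatT F N (TcanOfRecord F N)
                (chiFixed29 F N (theta13OfThm1C F N ε₀ ε₂₉ B₃ a₀ a₁).ν (theta13OfThm1C F N ε₀ ε₂₉ B₃ a₀ a₁).ε₂₉)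
                (theta13OfThm1C F N ε₀ ε₂₉ B₃ a₀ a₁).εbg) (theta13OfThm1C F N ε₀ ε₂₉ B₃ a₀ a₁).ρ8
                (theta13OfThm1C F N ε₀ ε₂₉ B₃ a₀ a₁).bV k v =
              beta0OfMerged (betaMerged F (mergedTermFamilyMatT F N (TcanOfRecord F N)
                  (chiFixed29 F N (theta13OfThm1C F N ε₀ ε₂₉ B₃ a₀ a₁).ν (theta13OfThm1C F N ε₀ ε₂₉ B₃ a₀ a₁).ε₂₉)
                  (theta13OfThm1C F N ε₀ ε₂₉ B₃ a₀ a₁).εbg) (theta13OfThm1C F N ε₀ ε₂₉ B₃ a₀ a₁).ρ8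
                  (theta13OfThm1C F N ε₀ ε₂₉ B₃ a₀ a₁).bV) (theta13OfThm1C F N ε₀ ε₂₉ B₃ a₀ a₁).v₀ k +
                B12Beta.secondMoment (fun _ _ => limKernel (A1 k v)) μ ν)
        -- N10's in-edge in the FAMILY currency at every run and the member letters law on the box, at the Stage-12 part (faithful letters of record of θ₁₅ᶜ)
        (_hcF : ∀ P k v, v ∈ Box γ₀ k → (lamF P k v).c = c13OfRecord₁₂ F N (theta13OfThm1C F N ε₀ ε₂₉ B₃ a₀ a₁).toStage12Params { c₀ with ε₁ := ε₂₉ })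
        (_hleafF : ∀ P, B13FamLeafOfRecord₁₂ F N (theta13OfThm1C F N ε₀ ε₂₉ B₃ a₀ a₁).toStage12Params { c₀ with ε₁ := ε₂₉ } lamF P)
        -- per (scale, history) IN THE BOX: a RUN SEQUENCE whose members AT THAT HISTORY have growing coarse tori, their laws and restriction sentences
        (Ps : (k : ℕ) → (Fin (k + 1) → ℝ) → ℕ → B12.RunParams)
        (_hn : ∀ k v, v ∈ Box γ₀ k → Tendsto (fun m => (lamF (Ps k v m) k v).n) atTop atTop)
        (_hsp : ∀ k v, v ∈ Box γ₀ k → ∀ m, SpLaw (lamF (Ps k v m) k v))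
        (_h213 : ∀ k v, v ∈ Box γ₀ k → ∀ m, Law213 (lamF (Ps k v m) k v))
        (_hR : ∀ k v, v ∈ Box γ₀ k → ∀ m, (lamF (Ps k v m) k v).Restr)
        -- N1 at the FAITHFUL letters of θ₁₅ᶜ DISCHARGED modulo the open letter below the threshold (`hsmall₁`) and the `A₂` row (n26-c `condsL_faithful_theta13OfThm1C_of_eps_le`); N3
        (_hsmall₁ : 2 * ((F.L : ℝ) + 2) ^ 4 * c₀.A₁ * c₀.K₀ * ε₂₉ * Real.exp (5 * 20000 + 1) * K₀ 64 8 * 9 * 64 ≤ 1)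
        (_hA₂ : Real.exp 1 * 9 * 64 * K₀ 64 8 ^ 2 ≤ c₀.A₂)
        (_hs : SignsL (c13OfRecord₁₂ F N (theta13OfThm1C F N ε₀ ε₂₉ B₃ a₀ a₁).toStage12Params { c₀ with ε₁ := ε₂₉ }) α₂ q.B₃)
        -- ANY admissible regularity display and positivity witness of `Δ_{a,k}(1)` per (k, v, m) on the tower over the member's torus
        (αU : (k : ℕ) → (Fin (k + 1) → ℝ) → ℕ → ℕ → ℝ) (hα1 : ∀ k v m j, αU k v m j ≤ 1 / 64)
        (hαL : ∀ k v m j, 50 * (((4 : ℕ) : ℝ) + 1) * αU k v m j * (L : ℝ) ^ 4 ≤ 1 / 2)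
        (hU1 : ∀ k v m (j : ℕ) (z : B7Prop1Explicit.Site 4) (κ : Fin 4),
          perCfg (towerP L (fun _ : Fin 4 => NOfLayers (fun m => lamF (Ps k v m) k v) m * M) (j + 1))
            (UlevOf L (fun _ : Fin 4 => NOfLayers (fun m => lamF (Ps k v m) k v) m * M) (k + 1) (fun _ => (1 : 𝔸ˣ)) j) z κ ∈ U1 𝔸)
        (hreg : ∀ k v m (j : ℕ) (y : TSite 4 (towerP L (fun _ : Fin 4 => NOfLayers (fun m => lamF (Ps k v m) k v) m * M) j)) (κ : Fin 4)
          (ρ' : Fin 4 → Fin L),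
          ‖((Wcx L (perCfg (towerP L (fun _ : Fin 4 => NOfLayers (fun m => lamF (Ps k v m) k v) m * M) (j + 1))
              (UlevOf L (fun _ : Fin 4 => NOfLayers (fun m => lamF (Ps k v m) k v) m * M) (k + 1) (fun _ => (1 : 𝔸ˣ)) j))
              (cornerSite L y) κ (boxVec L ρ') : 𝔸ˣ) : 𝔸) - 1‖ ≤ αU k v m j)
        (hpos : ∀ k v m (u : BondL2K ℂ 4 (towerP L (fun _ : Fin 4 => NOfLayers (fun m => lamF (Ps k v m) k v) m * M) (k + 1)) (cw₀ k) W), u ≠ 0 →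
          0 < RCLike.re ⟪u, laplaceAk L (fun _ : Fin 4 => NOfLayers (fun m => lamF (Ps k v m) k v) m * M) k φ (η k) (fun _ => (1 : 𝔸ˣ)) hL
            (αU k v m) (hα1 k v m) (hU1 k v m) (hreg k v m) τ (c₀ := cw₀ k) (c₁ := cw₁ k) aQ u⟫_ℂ)
        -- the (4.4) seams FROM THE TOWER's FINE BOND FIELDS into the members' spaces p. 15, the members' ACTIVITIES holomorphic along them (on the box)
        (emb : (k : ℕ) → (v : Fin (k + 1) → ℝ) → (m : ℕ) → TDom 4 ((lamF (Ps k v m) k v).n + 1) → (Bond 4 (towerP L (fun _ : Fin 4 => NOfLayers (fun m => lamF (Ps k v m) k v) m * M) (k + 1)) → W) → (lamF (Ps k v m) k v).Φ)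
        (_hemb : ∀ k v, v ∈ Box γ₀ k → ∀ m X, ∀ u ∈ ball (0 : Bond 4 (towerP L (fun _ : Fin 4 => NOfLayers (fun m => lamF (Ps k v m) k v) m * M) (k + 1)) → W) α₂, emb k v m X u ∈ (lamF (Ps k v m) k v).sp2 X)
        (_hH : ∀ k v, v ∈ Box γ₀ k → ∀ m (X Z : TDom 4 ((lamF (Ps k v m) k v).n + 1)), Z.1 ⊆ X.1 →
          DifferentiableOn ℂ (fun u => (lamF (Ps k v m) k v).H Z (emb k v m X u)) (ball 0 α₂))
        -- the (1.7) ∕ test-vector-limit data (on the box), the limit READ ON THE EXPLICIT FLAT TEST VECTORS, and the read-out of the leaf kernels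
        (V : (k : ℕ) → (Fin (k + 1) → ℝ) → LDom 4 → Type) (_instV : ∀ k v Y, NormedAddCommGroup (V k v Y))
        (_instVs : ∀ k v Y, NormedSpace ℂ (V k v Y))
        (Fw : (k : ℕ) → (v : Fin (k + 1) → ℝ) → (Y : LDom 4) → V k v Y → ℂ)
        (_hFd : ∀ k v, v ∈ Box γ₀ k → ∀ Y, ∃ ρ > 0, DifferentiableOn ℂ (Fw k v Y) (ball 0 ρ))
        (r : (k : ℕ) → (v : Fin (k + 1) → ℝ) → (m : ℕ) → (Y : LDom 4) → (Bond 4 (towerP L (fun _ : Fin 4 => NOfLayers (fun m => lamF (Ps k v m) k v) m * M) (k + 1)) → W) →L[ℂ] V k v Y)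
        (_hfac : ∀ k v, v ∈ Box γ₀ k → ∀ Y : LDom 4, ∀ᶠ m in atTop, ∀ u ∈ ball (0 : Bond 4 (towerP L (fun _ : Fin 4 => NOfLayers (fun m => lamF (Ps k v m) k v) m * M) (k + 1)) → W) α₂,
          (lamF (Ps k v m) k v).Ek1 (tproj ((lamF (Ps k v m) k v).n + 1) Y) (emb k v m (tproj ((lamF (Ps k v m) k v).n + 1) Y) u) = Fw k v Y (r k v m Y u))
        (t : (k : ℕ) → (v : Fin (k + 1) → ℝ) → (Y : LDom 4) → Pt 4 → V k v Y)
        (_hconv : ∀ k v, v ∈ Box γ₀ k → ∀ (Y : LDom 4) (x : Pt 4),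
          Tendsto (fun m => r k v m Y
            (fun b : Bond 4 (towerP L (fun _ : Fin 4 => NOfLayers (fun m => lamF (Ps k v m) k v) m * M) (k + 1)) =>
              if tcubeOf (NOfLayers (fun m => lamF (Ps k v m) k v) m) M (fun i => ((blockCoord (L ^ (k + 1)) (fun _ : Fin 4 => NOfLayers (fun m => lamF (Ps k v m) k v) m * M)
                    (siteCast (towerP_eq_fineP_pow L (fun _ : Fin 4 => NOfLayers (fun m => lamF (Ps k v m) k v) m * M) (k + 1)) (bpos b)) i : ℕ) :
                      ZMod (NOfLayers (fun m => lamF (Ps k v m) k v) m * M))) ∈ (tproj ((lamF (Ps k v m) k v).n + 1) Y).1 then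
                ((WL2.linearEquiv ℂ ℂ (fun _ : Bond 4 (towerP L (fun _ : Fin 4 => NOfLayers (fun m => lamF (Ps k v m) k v) m * M) (k + 1)) => cw₀ k) :
                    BondL2K ℂ 4 (towerP L (fun _ : Fin 4 => NOfLayers (fun m => lamF (Ps k v m) k v) m * M) (k + 1)) (cw₀ k) W ≃ₗ[ℂ] (Bond 4 (towerP L (fun _ : Fin 4 => NOfLayers (fun m => lamF (Ps k v m) k v) m * M) (k + 1)) → W))
                  (H1k L (fun _ : Fin 4 => NOfLayers (fun m => lamF (Ps k v m) k v) m * M) k φ (η k) (fun _ => (1 : 𝔸ˣ)) hL (αU k v m) (hα1 k v m)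
                    (hU1 k v m) (hreg k v m) τ (c₀ := cw₀ k) (c₁ := cw₁ k) (hαL k v m) (hpos k v m)
                    ((WL2.linearEquiv ℂ ℂ (fun _ : Bond 4 (fun _ : Fin 4 => NOfLayers (fun m => lamF (Ps k v m) k v) m * M) => cw₁ k) :
                        BondL2K ℂ 4 (fun _ : Fin 4 => NOfLayers (fun m => lamF (Ps k v m) k v) m * M) (cw₁ k) W ≃ₗ[ℂ]
                          (Bond 4 (fun _ : Fin 4 => NOfLayers (fun m => lamF (Ps k v m) k v) m * M) → W)).symm
                      (Pi.single ((fun i => (⟨((proj (((lamF (Ps k v m) k v).n + 1) * M) x) i).val,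
                          ZMod.val_lt ((proj (((lamF (Ps k v m) k v).n + 1) * M) x) i)⟩ : Fin (NOfLayers (fun m => lamF (Ps k v m) k v) m * M))), μ₀) w₀)))) b
              else 0)) atTop (𝓝 (t k v Y x)))
        (_ha : ∀ k v, v ∈ Box γ₀ k → ∀ (Y : LDom 4) (z : Pt 4), A1 k v Y z = (mixedDeriv (Fw k v Y) (t k v Y 0) (t k v Y z)).re)
        -- the box is a positive box, N3, the one-loop slope at (D1)'s step normalization, (C-leaf) in the (1.7) read-out letters
        (_hγ₀ : 0 < γ₀) (_hq : q.Valid (c13OfRecord₁₂ F N (theta13OfThm1C F N ε₀ ε₂₉ B₃ a₀ a₁).toStage12Params { c₀ with ε₁ := ε₂₉ }).δ₀) (Lc : ℕ) (Nc : ℝ)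
        (_hsmall : ε₂₉ * remCoeffL 4 M (c13OfRecord₁₂ F N (theta13OfThm1C F N ε₀ ε₂₉ B₃ a₀ a₁).toStage12Params { c₀ with ε₁ := ε₂₉ }) α₂ q.B₃ ≤
          B12Normalization.stepBal Nc Lc)
        (_hcont : ∀ k (Y : LDom 4) (z : Pt 4),
          ContinuousOn (fun v : Fin (k + 1) → ℝ => (mixedDeriv (Fw k v Y) (t k v Y 0) (t k v Y z)).re) (Box γ₀ k)),
      letI := (theta13OfThm1C F N ε₀ ε₂₉ B₃ a₀ a₁).instVβ₁; letI := (theta13OfThm1C F N ε₀ ε₂₉ B₃ a₀ a₁).instVβ₂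
      letI := (theta13OfThm1C F N ε₀ ε₂₉ B₃ a₀ a₁).instιβ
      ∃ γ₁ : ℝ, 0 < γ₁ ∧ γ₁ ≤ (theta13OfThm1C F N ε₀ ε₂₉ B₃ a₀ a₁).γ ∧
        AtSlopeCont
          (oneLoopSplit_betaOfMerged
            (betaMerged F (mergedTermFamilyMatT F N (TcanOfRecord F N)
              (chiFixed29 F N (theta13OfThm1C F N ε₀ ε₂₉ B₃ a₀ a₁).ν (theta13OfThm1C F N ε₀ ε₂₉ B₃ a₀ a₁).ε₂₉)
              (theta13OfThm1C F N ε₀ ε₂₉ B₃ a₀ a₁).εbg) (theta13OfThm1C F N ε₀ ε₂₉ B₃ a₀ a₁).ρ8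
              (theta13OfThm1C F N ε₀ ε₂₉ B₃ a₀ a₁).bV)
            (beta0OfMerged (betaMerged F (mergedTermFamilyMatT F N (TcanOfRecord F N)
              (chiFixed29 F N (theta13OfThm1C F N ε₀ ε₂₉ B₃ a₀ a₁).ν (theta13OfThm1C F N ε₀ ε₂₉ B₃ a₀ a₁).ε₂₉)
              (theta13OfThm1C F N ε₀ ε₂₉ B₃ a₀ a₁).εbg) (theta13OfThm1C F N ε₀ ε₂₉ B₃ a₀ a₁).ρ8
              (theta13OfThm1C F N ε₀ ε₂₉ B₃ a₀ a₁).bV) (theta13OfThm1C F N ε₀ ε₂₉ B₃ a₀ a₁).v₀)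
            (theta13OfThm1C F N ε₀ ε₂₉ B₃ a₀ a₁).γ)
          γ₁ (B12Normalization.stepBal Nc Lc) := by
  obtain ⟨δs, Cs, hδs, hCs, H⟩ :=
    d4AtSlopeOfD1Record13_at_of_family_towerFlat F N L hL hL3 φ hMφ hMφ' hφ hφ' haQ haQ' τ hτ hCτ hτm hMτ hρw hτ₁ hτ₂ hφτ AQ hAQ16
  refine ⟨δs, Cs, hδs, hCs, ?_⟩
  intro η hηL cw₀ cw₁ _ _ hw hρ M _ I i₀ η₀ L₀ M₀ Rg Hg μ₀ w₀ q δr hδr hσ₀ hcR hκB hδ15 hCst hmw hθ1 γ₀ μ ν α₂ lamF hle A1 hm hcF hleafF Ps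
    hn hsp h213 hR hsmall₁ hA₂ hs αU hα1 hαL hU1 hreg hpos emb hemb hH V instV instVs Fw hFd r hfac t hconv ha hγ₀ hq Lc Nc hsmall hcont
  exact H η hηL cw₀ cw₁ hw hρ M I i₀ η₀ L₀ M₀ Rg Hg μ₀ w₀ q δr hδr hσ₀ hcR hκB hδ15 hCst hmw hθ1 γ₀ μ ν α₂ (theta13OfThm1C F N ε₀ ε₂₉ B₃ a₀ a₁)
    { c₀ with ε₁ := ε₂₉ } lamF hle A1 hm hcF hleafF Ps hn hsp h213 hR
    (condsL_faithful_theta13OfThm1C_of_eps_le F N ε₀ B₃ a₀ a₁ hsmall₁ hA₂) hs αU hα1 hαL hU1 hreg hpos emb hemb hH V instV instVs Fw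
    hFd r hfac t hconv ha hγ₀ hq Lc Nc hsmall hcont

/-! ## §2 ★ FOR EVERY POSITIVE SLOPE, ONE MEMBER OF THE [15]-KEYED FAMILY AT WHICH THE (D4) PRODUCT HOLDS WITH THE β-SIDE ROWS PAID AND NODE D SUPPLIED (n26-c's §1c ∘ p492935 (ii)) -/

variable {ε₀ B₃ a₀ a₁} in
/-- **★ FOR EVERY POSITIVE SLOPE `s`, ONE MEMBER OF NODE 00's COMPATIBLE [15]-KEYED FAMILY AT WHICH THE (D4) PRODUCT `∃ γ₁ ∈ ]0, θ₁₅ᶜ.γ], AtSlopeCont (split₁₃ θ₁₅ᶜ) γ₁ s`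
HOLDS WITH THE β-SIDE ROWS PAID AND NODE D SUPPLIED** — n26-c's `exists_eps29_rows_theta13OfThm1C` ∘ p492935 clause (ii): for `0 < ε₀`, `0 ≤ B₃`, `0 < a₀`, `0 < a₁`, NE9's
structure data and thresholds `(δs, Cs)`, tower weights, cube side `M` ∕ geometry letters ∕ numerics on `q`, a box `γ₀`, channel `(μ, ν)`, (4.4)-radius `α₂`, residual `c₀` and
ANY `s > 0`, THERE IS `ε₂₉ > 0` with `4ε₂₉ < ε₀`, θ₁₅ᶜ(ε₀, ε₂₉; B₃, a₀, a₁) Stage-13 ADMISSIBLE and `ZtUnity` (rows G, Z) such that AT THAT MEMBER — from the Stage-12 [B13] family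
of record with N10's family leaf and the member letters law at the faithful letters `{ c₀ with ε₁ := ε₂₉, A₂ := e·576·K₀(64,8)² }`, the leaf kernels with the (1.22)
identification at the ₁₃ merged β, the run sequences ∕ laws ∕ `Restr` (NODE O ∕ 00 ∕ A), N3, ANY regularity display ∕ positivity witness, the (4.4) seams from the tower's fine
bond fields with holomorphic activities (NODE B), the (1.7) data with `hconv` on the explicit flat (4.35) vectors and the read-out (NODE E), `0 < γ₀`, `Valid` and (C-leaf) ALONE —
`∃ γ₁, 0 < γ₁ ∧ γ₁ ≤ θ₁₅ᶜ.γ ∧ AtSlopeCont (split₁₃ θ₁₅ᶜ) γ₁ s` (witness `γ₁ := γ₀`).  The N1 row (`CondsL` at the faithful letters) AND the (D1)∕(D4) seam row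
`ε₂₉·K_rem,L ≤ s` are CONSUMED — paid by the choice of the member (`ε₂₉ ≤ min(ε₀∕8, 1∕(|C|+1), s∕(|K|+1))`, chosen AFTER `M, α₂, q.B₃, c₀, s`) — and NODE D is SUPPLIED
(p492935's «Y19» datum at `N := NOfLayers (m ↦ lamF (Ps k v m) k v)`).  The slope `s` is a FREE positive letter: at a (D1) datum `(Lc, Js, Nc)` of the member it is
`stepBal Nc Lc` (§1 ∕ the stub), and `ε₂₉` is NOT chosen here after a (D1) datum of the same member — whether the members' (D1) slopes have a common positive lower bound as
`ε₂₉ ↓ 0` ([I] (2.12)–(2.13) p. 268: `β⁰` does not read the (2.9) threshold) is the (D1) lane's sentence.  The (D4) OWNER's «rows consumed, NODE D supplied» deliverable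
(pub-ymgap READ l.16404 (2)) on the «witness with small ε₂₉» branch; a REDUCTION — nothing of Bałaban's objects asserted; NODE D on the MODEL class; (D4) instance 0∕1;
`stub_d4AtSlopeCont13` ∕ K2‴ NOT proved.
[cite: Balaban1987RG1, (0.21) p.256, (1.2) p.260, (1.7) p.261, (1.18) p.263, (1.20)-(1.22) p.264, (2.9) p.266, (2.12)-(2.13) p.268, (4.4) p.281, (4.35) p.290, (5.1) p.292; Balaban1988RG2Cluster, Lemma 3 (2.38) p.20 and p.21; Balaban1988Convergent, (2.10) p.256; Balaban1985Variational, Thm 1 p.279, (190) p.308] -/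
theorem exists_eps29_d4AtSlope_theta13OfThm1C_of_family_towerFlat (hε : 0 < ε₀) (hB : 0 ≤ B₃) (ha₀ : 0 < a₀) (ha₁ : 0 < a₁) :
    ∃ δs Cs : ℝ, 0 < δs ∧ 0 ≤ Cs ∧
      ∀ -- tower weights per scale `k` (height `k + 1`)
        (η : ℕ → ℝ) (_hηL : ∀ k, η k * (L : ℝ) ^ (k + 1) = 1) (cw₀ cw₁ : ℕ → ℝ) [∀ k, Fact (0 < cw₀ k)] [∀ k, Fact (0 < cw₁ k)]
        (_hw : ∀ k, cw₀ k * ((L : ℝ) ^ (k + 1)) ^ 4 = cw₁ k) (_hρ : ∀ k, |η k| ^ 4 / cw₀ k ≤ ρw)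
        -- cube side, size indices, block-geometry letters, source direction ∕ value, the (190)-record under numerics only
        (M : ℕ) [NeZero M] (I : Type) (_i₀ : I) (η₀ L₀ M₀ Rg : ℕ → ℝ) (Hg : ℕ → Prop) (μ₀ : Fin 4) (w₀ : W)
        (q : Consts190) (δr : ℝ) (_hδr : 0 < δr) (_hσ₀ : 0 < q.σ) (_hcR : B6.c0 δr (q.σ / δr) ^ 4 ≤ q.cR) (_hκB : 1 ≤ q.κB)
        (_hδ15 : q.δ15 ≤ δs) (_hCst : Cs ≤ q.Cst) (_hmw : ‖w₀‖ ≤ q.m) (_hθ1 : q.θ ≤ 1)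
        (γ₀ : ℝ) (μ ν : Fin 4) (α₂ : ℝ) (c₀ : B13.Consts) (s : ℝ) (_hs0 : 0 < s),
      ∃ ε₂₉ : ℝ, 0 < ε₂₉ ∧ 4 * ε₂₉ < ε₀ ∧ (theta13OfThm1C F N ε₀ ε₂₉ B₃ a₀ a₁).Admissible F N ∧ (theta13OfThm1C F N ε₀ ε₂₉ B₃ a₀ a₁).ZtUnity F N ∧
      ∀ -- AT THAT MEMBER: a Stage-12 [B13] FAMILY of record with the FAITHFUL letters (minimal `A₂`), the box, the leaf kernels with the (1.22) identification
        (lamF : ResidB13Fam₁₂ F N (theta13OfThm1C F N ε₀ ε₂₉ B₃ a₀ a₁).toStage12Params)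
        (_hle : γ₀ ≤ (theta13OfThm1C F N ε₀ ε₂₉ B₃ a₀ a₁).γ) (A1 : (k : ℕ) → (Fin (k + 1) → ℝ) → LDom 4 → Pt 4 → ℝ)
        (_hm : letI := (theta13OfThm1C F N ε₀ ε₂₉ B₃ a₀ a₁).instVβ₁; letI := (theta13OfThm1C F N ε₀ ε₂₉ B₃ a₀ a₁).instVβ₂
          letI := (theta13OfThm1C F N ε₀ ε₂₉ B₃ a₀ a₁).instιβ
          ∀ k (v : Fin (k + 1) → ℝ), v ∈ Box γ₀ k →
            betaMerged F (mergedTermFamilyMatT F N (TcanOfRecord F N)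
                (chiFixed29 F N (theta13OfThm1C F N ε₀ ε₂₉ B₃ a₀ a₁).ν (theta13OfThm1C F N ε₀ ε₂₉ B₃ a₀ a₁).ε₂₉)
                (theta13OfThm1C F N ε₀ ε₂₉ B₃ a₀ a₁).εbg) (theta13OfThm1C F N ε₀ ε₂₉ B₃ a₀ a₁).ρ8
                (theta13OfThm1C F N ε₀ ε₂₉ B₃ a₀ a₁).bV k v =
              beta0OfMerged (betaMerged F (mergedTermFamilyMatT F N (TcanOfRecord F N)
                  (chiFixed29 F N (theta13OfThm1C F N ε₀ ε₂₉ B₃ a₀ a₁).ν (theta13OfThm1C F N ε₀ ε₂₉ B₃ a₀ a₁).ε₂₉)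
                  (theta13OfThm1C F N ε₀ ε₂₉ B₃ a₀ a₁).εbg) (theta13OfThm1C F N ε₀ ε₂₉ B₃ a₀ a₁).ρ8
                  (theta13OfThm1C F N ε₀ ε₂₉ B₃ a₀ a₁).bV) (theta13OfThm1C F N ε₀ ε₂₉ B₃ a₀ a₁).v₀ k +
                B12Beta.secondMoment (fun _ _ => limKernel (A1 k v)) μ ν)
        -- N10's in-edge in the FAMILY currency at every run and the member letters law on the box, at the Stage-12 part (faithful letters of record of the member)
        (_hcF : ∀ P k v, v ∈ Box γ₀ k → (lamF P k v).c = c13OfRecord₁₂ F N (theta13OfThm1C F N ε₀ ε₂₉ B₃ a₀ a₁).toStage12Params { c₀ with ε₁ := ε₂₉, A₂ := Real.exp 1 * 9 * 64 * K₀ 64 8 ^ 2 })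
        (_hleafF : ∀ P, B13FamLeafOfRecord₁₂ F N (theta13OfThm1C F N ε₀ ε₂₉ B₃ a₀ a₁).toStage12Params { c₀ with ε₁ := ε₂₉, A₂ := Real.exp 1 * 9 * 64 * K₀ 64 8 ^ 2 } lamF P)
        -- per (scale, history) IN THE BOX: a RUN SEQUENCE whose members AT THAT HISTORY have growing coarse tori, their laws and restriction sentences
        (Ps : (k : ℕ) → (Fin (k + 1) → ℝ) → ℕ → B12.RunParams)
        (_hn : ∀ k v, v ∈ Box γ₀ k → Tendsto (fun m => (lamF (Ps k v m) k v).n) atTop atTop)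
        (_hsp : ∀ k v, v ∈ Box γ₀ k → ∀ m, SpLaw (lamF (Ps k v m) k v))
        (_h213 : ∀ k v, v ∈ Box γ₀ k → ∀ m, Law213 (lamF (Ps k v m) k v))
        (_hR : ∀ k v, v ∈ Box γ₀ k → ∀ m, (lamF (Ps k v m) k v).Restr)
        -- N3 (N1 and the seam row are PAID by the choice of the member)
        (_hs : SignsL (c13OfRecord₁₂ F N (theta13OfThm1C F N ε₀ ε₂₉ B₃ a₀ a₁).toStage12Params { c₀ with ε₁ := ε₂₉, A₂ := Real.exp 1 * 9 * 64 * K₀ 64 8 ^ 2 }) α₂ q.B₃)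
        -- ANY admissible regularity display and positivity witness of `Δ_{a,k}(1)` per (k, v, m) on the tower over the member's torus
        (αU : (k : ℕ) → (Fin (k + 1) → ℝ) → ℕ → ℕ → ℝ) (hα1 : ∀ k v m j, αU k v m j ≤ 1 / 64)
        (hαL : ∀ k v m j, 50 * (((4 : ℕ) : ℝ) + 1) * αU k v m j * (L : ℝ) ^ 4 ≤ 1 / 2)
        (hU1 : ∀ k v m (j : ℕ) (z : B7Prop1Explicit.Site 4) (κ : Fin 4),
          perCfg (towerP L (fun _ : Fin 4 => NOfLayers (fun m => lamF (Ps k v m) k v) m * M) (j + 1))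
            (UlevOf L (fun _ : Fin 4 => NOfLayers (fun m => lamF (Ps k v m) k v) m * M) (k + 1) (fun _ => (1 : 𝔸ˣ)) j) z κ ∈ U1 𝔸)
        (hreg : ∀ k v m (j : ℕ) (y : TSite 4 (towerP L (fun _ : Fin 4 => NOfLayers (fun m => lamF (Ps k v m) k v) m * M) j)) (κ : Fin 4)
          (ρ' : Fin 4 → Fin L),
          ‖((Wcx L (perCfg (towerP L (fun _ : Fin 4 => NOfLayers (fun m => lamF (Ps k v m) k v) m * M) (j + 1))
              (UlevOf L (fun _ : Fin 4 => NOfLayers (fun m => lamF (Ps k v m) k v) m * M) (k + 1) (fun _ => (1 : 𝔸ˣ)) j))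
              (cornerSite L y) κ (boxVec L ρ') : 𝔸ˣ) : 𝔸) - 1‖ ≤ αU k v m j)
        (hpos : ∀ k v m (u : BondL2K ℂ 4 (towerP L (fun _ : Fin 4 => NOfLayers (fun m => lamF (Ps k v m) k v) m * M) (k + 1)) (cw₀ k) W), u ≠ 0 →
          0 < RCLike.re ⟪u, laplaceAk L (fun _ : Fin 4 => NOfLayers (fun m => lamF (Ps k v m) k v) m * M) k φ (η k) (fun _ => (1 : 𝔸ˣ)) hL
            (αU k v m) (hα1 k v m) (hU1 k v m) (hreg k v m) τ (c₀ := cw₀ k) (c₁ := cw₁ k) aQ u⟫_ℂ)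
        -- the (4.4) seams FROM THE TOWER's FINE BOND FIELDS into the members' spaces p. 15, the members' ACTIVITIES holomorphic along them (on the box)
        (emb : (k : ℕ) → (v : Fin (k + 1) → ℝ) → (m : ℕ) → TDom 4 ((lamF (Ps k v m) k v).n + 1) → (Bond 4 (towerP L (fun _ : Fin 4 => NOfLayers (fun m => lamF (Ps k v m) k v) m * M) (k + 1)) → W) → (lamF (Ps k v m) k v).Φ)
        (_hemb : ∀ k v, v ∈ Box γ₀ k → ∀ m X, ∀ u ∈ ball (0 : Bond 4 (towerP L (fun _ : Fin 4 => NOfLayers (fun m => lamF (Ps k v m) k v) m * M) (k + 1)) → W) α₂, emb k v m X u ∈ (lamF (Ps k v m) k v).sp2 X)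
        (_hH : ∀ k v, v ∈ Box γ₀ k → ∀ m (X Z : TDom 4 ((lamF (Ps k v m) k v).n + 1)), Z.1 ⊆ X.1 →
          DifferentiableOn ℂ (fun u => (lamF (Ps k v m) k v).H Z (emb k v m X u)) (ball 0 α₂))
        -- the (1.7) ∕ test-vector-limit data (on the box), the limit READ ON THE EXPLICIT FLAT TEST VECTORS, and the read-out of the leaf kernels
        (V : (k : ℕ) → (Fin (k + 1) → ℝ) → LDom 4 → Type) (_instV : ∀ k v Y, NormedAddCommGroup (V k v Y))
        (_instVs : ∀ k v Y, NormedSpace ℂ (V k v Y))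
        (Fw : (k : ℕ) → (v : Fin (k + 1) → ℝ) → (Y : LDom 4) → V k v Y → ℂ)
        (_hFd : ∀ k v, v ∈ Box γ₀ k → ∀ Y, ∃ ρ > 0, DifferentiableOn ℂ (Fw k v Y) (ball 0 ρ))
        (r : (k : ℕ) → (v : Fin (k + 1) → ℝ) → (m : ℕ) → (Y : LDom 4) → (Bond 4 (towerP L (fun _ : Fin 4 => NOfLayers (fun m => lamF (Ps k v m) k v) m * M) (k + 1)) → W) →L[ℂ] V k v Y)
        (_hfac : ∀ k v, v ∈ Box γ₀ k → ∀ Y : LDom 4, ∀ᶠ m in atTop, ∀ u ∈ ball (0 : Bond 4 (towerP L (fun _ : Fin 4 => NOfLayers (fun m => lamF (Ps k v m) k v) m * M) (k + 1)) → W) α₂,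
          (lamF (Ps k v m) k v).Ek1 (tproj ((lamF (Ps k v m) k v).n + 1) Y) (emb k v m (tproj ((lamF (Ps k v m) k v).n + 1) Y) u) = Fw k v Y (r k v m Y u))
        (t : (k : ℕ) → (v : Fin (k + 1) → ℝ) → (Y : LDom 4) → Pt 4 → V k v Y)
        (_hconv : ∀ k v, v ∈ Box γ₀ k → ∀ (Y : LDom 4) (x : Pt 4),
          Tendsto (fun m => r k v m Y
            (fun b : Bond 4 (towerP L (fun _ : Fin 4 => NOfLayers (fun m => lamF (Ps k v m) k v) m * M) (k + 1)) =>
              if tcubeOf (NOfLayers (fun m => lamF (Ps k v m) k v) m) M (fun i => ((blockCoord (L ^ (k + 1)) (fun _ : Fin 4 => NOfLayers (fun m => lamF (Ps k v m) k v) m * M)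
                    (siteCast (towerP_eq_fineP_pow L (fun _ : Fin 4 => NOfLayers (fun m => lamF (Ps k v m) k v) m * M) (k + 1)) (bpos b)) i : ℕ) :
                      ZMod (NOfLayers (fun m => lamF (Ps k v m) k v) m * M))) ∈ (tproj ((lamF (Ps k v m) k v).n + 1) Y).1 then
                ((WL2.linearEquiv ℂ ℂ (fun _ : Bond 4 (towerP L (fun _ : Fin 4 => NOfLayers (fun m => lamF (Ps k v m) k v) m * M) (k + 1)) => cw₀ k) :
                    BondL2K ℂ 4 (towerP L (fun _ : Fin 4 => NOfLayers (fun m => lamF (Ps k v m) k v) m * M) (k + 1)) (cw₀ k) W ≃ₗ[ℂ] (Bond 4 (towerP L (fun _ : Fin 4 => NOfLayers (fun m => lamF (Ps k v m) k v) m * M) (k + 1)) → W))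
                  (H1k L (fun _ : Fin 4 => NOfLayers (fun m => lamF (Ps k v m) k v) m * M) k φ (η k) (fun _ => (1 : 𝔸ˣ)) hL (αU k v m) (hα1 k v m)
                    (hU1 k v m) (hreg k v m) τ (c₀ := cw₀ k) (c₁ := cw₁ k) (hαL k v m) (hpos k v m)
                    ((WL2.linearEquiv ℂ ℂ (fun _ : Bond 4 (fun _ : Fin 4 => NOfLayers (fun m => lamF (Ps k v m) k v) m * M) => cw₁ k) :
                        BondL2K ℂ 4 (fun _ : Fin 4 => NOfLayers (fun m => lamF (Ps k v m) k v) m * M) (cw₁ k) W ≃ₗ[ℂ]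
                          (Bond 4 (fun _ : Fin 4 => NOfLayers (fun m => lamF (Ps k v m) k v) m * M) → W)).symm
                      (Pi.single ((fun i => (⟨((proj (((lamF (Ps k v m) k v).n + 1) * M) x) i).val,
                          ZMod.val_lt ((proj (((lamF (Ps k v m) k v).n + 1) * M) x) i)⟩ : Fin (NOfLayers (fun m => lamF (Ps k v m) k v) m * M))), μ₀) w₀)))) b
              else 0)) atTop (𝓝 (t k v Y x)))
        (_ha : ∀ k v, v ∈ Box γ₀ k → ∀ (Y : LDom 4) (z : Pt 4), A1 k v Y z = (mixedDeriv (Fw k v Y) (t k v Y 0) (t k v Y z)).re)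
        -- the box is a positive box, the (190) numerics validity at the letters, (C-leaf) in the (1.7) read-out letters
        (_hγ₀ : 0 < γ₀) (_hq : q.Valid (c13OfRecord₁₂ F N (theta13OfThm1C F N ε₀ ε₂₉ B₃ a₀ a₁).toStage12Params { c₀ with ε₁ := ε₂₉, A₂ := Real.exp 1 * 9 * 64 * K₀ 64 8 ^ 2 }).δ₀)
        (_hcont : ∀ k (Y : LDom 4) (z : Pt 4),
          ContinuousOn (fun v : Fin (k + 1) → ℝ => (mixedDeriv (Fw k v Y) (t k v Y 0) (t k v Y z)).re) (Box γ₀ k)),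
      letI := (theta13OfThm1C F N ε₀ ε₂₉ B₃ a₀ a₁).instVβ₁; letI := (theta13OfThm1C F N ε₀ ε₂₉ B₃ a₀ a₁).instVβ₂
      letI := (theta13OfThm1C F N ε₀ ε₂₉ B₃ a₀ a₁).instιβ
      ∃ γ₁ : ℝ, 0 < γ₁ ∧ γ₁ ≤ (theta13OfThm1C F N ε₀ ε₂₉ B₃ a₀ a₁).γ ∧
        AtSlopeCont
          (oneLoopSplit_betaOfMerged
            (betaMerged F (mergedTermFamilyMatT F N (TcanOfRecord F N)
              (chiFixed29 F N (theta13OfThm1C F N ε₀ ε₂₉ B₃ a₀ a₁).ν (theta13OfThm1C F N ε₀ ε₂₉ B₃ a₀ a₁).ε₂₉)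
              (theta13OfThm1C F N ε₀ ε₂₉ B₃ a₀ a₁).εbg) (theta13OfThm1C F N ε₀ ε₂₉ B₃ a₀ a₁).ρ8
              (theta13OfThm1C F N ε₀ ε₂₉ B₃ a₀ a₁).bV)
            (beta0OfMerged (betaMerged F (mergedTermFamilyMatT F N (TcanOfRecord F N)
              (chiFixed29 F N (theta13OfThm1C F N ε₀ ε₂₉ B₃ a₀ a₁).ν (theta13OfThm1C F N ε₀ ε₂₉ B₃ a₀ a₁).ε₂₉)
              (theta13OfThm1C F N ε₀ ε₂₉ B₃ a₀ a₁).εbg) (theta13OfThm1C F N ε₀ ε₂₉ B₃ a₀ a₁).ρ8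
              (theta13OfThm1C F N ε₀ ε₂₉ B₃ a₀ a₁).bV) (theta13OfThm1C F N ε₀ ε₂₉ B₃ a₀ a₁).v₀)
            (theta13OfThm1C F N ε₀ ε₂₉ B₃ a₀ a₁).γ)
          γ₁ s := by
  obtain ⟨δs, Cs, hδs, hCs, H⟩ :=
    exists_chainTFac190H_betaOfRecord₁₃_of_family_towerFlat F N L hL hL3 φ hMφ hMφ' hφ hφ' haQ haQ' τ hτ hCτ hτm hMτ hρw hτ₁ hτ₂
      hφτ AQ hAQ16
  refine ⟨δs, Cs, hδs, hCs, ?_⟩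
  intro η hηL cw₀ cw₁ _ _ hw hρ M _ I i₀ η₀ L₀ M₀ Rg Hg μ₀ w₀ q δr hδr hσ₀ hcR hκB hδ15 hCst hmw hθ1 γ₀ μ ν α₂ c₀ s hs0
  obtain ⟨ε₂₉, hε0, h4, hAdm, hZt, hC, hsmall⟩ := exists_eps29_rows_theta13OfThm1C F N c₀ M α₂ q.B₃ hε hB ha₀ ha₁ hs0
  refine ⟨ε₂₉, hε0, h4, hAdm, hZt, ?_⟩
  intro lamF hle A1 hm hcF hleafF Ps hn hsp h213 hR hs αU hα1 hαL hU1 hreg hpos emb hemb hH V instV instVs Fw hFd r hfac t hconv ha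
    hγ₀ hq hcont
  exact ⟨γ₀, hγ₀, hle,
    (H η hηL cw₀ cw₁ hw hρ M I i₀ η₀ L₀ M₀ Rg Hg μ₀ w₀ q δr hδr hσ₀ hcR hκB hδ15 hCst hmw hθ1 γ₀ μ ν α₂ (theta13OfThm1C F N ε₀ ε₂₉ B₃ a₀ a₁)
      { c₀ with ε₁ := ε₂₉, A₂ := Real.exp 1 * 9 * 64 * K₀ 64 8 ^ 2 } lamF hle A1 hm hcF hleafF Ps hn hsp h213 hR hC hs αU hα1 hαL hU1
      hreg hpos emb hemb hH V instV instVs Fw hFd r hfac t hconv ha).2.1 hq s hsmall hcont⟩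

end AtTheta15C

end Summit.QuantumFields.YangMills.Theorems.BalabanUVNodesN26AtTheta13OfThm1CStubD4TowerFlat

end
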